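import Summits.HodgeConjecture.HodgeCM.PerL34.SeesawTorus_2

/-! PORT of `HodgeCM/PerL34/SeesawTorus.lean` (HodgeCMPerL run 82) — part 3: continuation of `Summits.HodgeConjecture.HodgeCM.PerL34.SeesawTorus_2` (split at a top-level declaration boundary by port_pkg.py; scope re-opened below; declarations unchanged). -/

-- port_pkg: scope re-opened for this part (file-level context, then the namespace/section stack open at the cut)
set_option autoImplicit false
noncomputable section
open MeasureTheory Topology Set Function
namespace NumberField
namespace SeesawArchTorus
variable (L : Type) [Field L] [NumberField L] [IsCMField L]
variable {L} in
/-- (Ported verbatim from the HodgeCMPerL package; no docstring in the source.) -/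
@[simp] theorem weight_inr (m₁ m₂ : InfinitePlace L → ℤ) (t : unitaryLineArchTorus L) :
    weight L m₁ m₂ (inr L t) = archWeight L m₂ t := by
  rw [weight_apply]; change archWeight L m₁ 1 * archWeight L m₂ t = _; rw [map_one, one_mul]

/-- `w` is unitary … -/
theorem norm_weight (m₁ m₂ : InfinitePlace L → ℤ) (t : SeesawArchTorus L) : ‖weight L m₁ m₂ t‖ = 1 := by
  rw [weight_apply, norm_mul, norm_archWeight, norm_archWeight, mul_one]

/-- … and continuous. -/
theorem continuous_weight (m₁ m₂ : InfinitePlace L → ℤ) : Continuous (weight L m₁ m₂) :=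
  ((continuous_archWeight L m₁).comp _root_.continuous_fst).mul
    ((continuous_archWeight L m₂).comp _root_.continuous_snd)

end SeesawArchTorus

/-! ## §8  Characters of `[T]`: `ξ = (χ′₁, χ′₂)`, `χ₁₂ = χ′₁ ⊠ χ′₂`, and the type condition `ξ_∞ = w` -/

namespace SeesawTorus

section Characters

variable (K L : Type) [Field K] [Field L] [NumberField L] [Algebra K L] [FiniteDimensional K L]

/-- The four structure maps of §4 as continuous homomorphisms. -/
def quotFstC : (SeesawTorus K L ⧸ rat K L) →ₜ* (relNormOneIdeles K L ⧸ relNormOneRat K L) :=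
  { quotFst K L with continuous_toFun := continuous_quotFst K L }
/-- (Ported verbatim from the HodgeCMPerL package; no docstring in the source.) -/
def quotSndC : (SeesawTorus K L ⧸ rat K L) →ₜ* (relNormOneIdeles K L ⧸ relNormOneRat K L) :=
  { quotSnd K L with continuous_toFun := continuous_quotSnd K L }
/-- (Ported verbatim from the HodgeCMPerL package; no docstring in the source.) -/
def quotInlC : (relNormOneIdeles K L ⧸ relNormOneRat K L) →ₜ* (SeesawTorus K L ⧸ rat K L) :=
  { quotInl K L with continuous_toFun := continuous_quotInl K L }
/-- (Ported verbatim from the HodgeCMPerL package; no docstring in the source.) -/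
def quotInrC : (relNormOneIdeles K L ⧸ relNormOneRat K L) →ₜ* (SeesawTorus K L ⧸ rat K L) :=
  { quotInr K L with continuous_toFun := continuous_quotInr K L }

variable {K L}

/-- (Ported verbatim from the HodgeCMPerL package; no docstring in the source.) -/
@[simp] theorem quotFstC_apply (q : SeesawTorus K L ⧸ rat K L) : quotFstC K L q = quotFst K L q := rfl
/-- (Ported verbatim from the HodgeCMPerL package; no docstring in the source.) -/
@[simp] theorem quotSndC_apply (q : SeesawTorus K L ⧸ rat K L) : quotSndC K L q = quotSnd K L q := rfl
/-- (Ported verbatim from the HodgeCMPerL package; no docstring in the source.) -/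
@[simp] theorem quotInlC_apply (q : relNormOneIdeles K L ⧸ relNormOneRat K L) : quotInlC K L q = quotInl K L q := rfl
/-- (Ported verbatim from the HodgeCMPerL package; no docstring in the source.) -/
@[simp] theorem quotInrC_apply (q : relNormOneIdeles K L ⧸ relNormOneRat K L) : quotInrC K L q = quotInr K L q := rfl

/-- **`χ′₁ := ξ|_{[U(W₁)]}`**, the first component of a character `ξ` of `[T]`. -/
def charFst (ξ : PontryaginDual (SeesawTorus K L ⧸ rat K L)) : PontryaginDual (relNormOneIdeles K L ⧸ relNormOneRat K L) :=
  ξ.comp (quotInlC K L)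

/-- **`χ′₂ := ξ|_{[U(W₂)]}`**, the second component. -/
def charSnd (ξ : PontryaginDual (SeesawTorus K L ⧸ rat K L)) : PontryaginDual (relNormOneIdeles K L ⧸ relNormOneRat K L) :=
  ξ.comp (quotInrC K L)

/-- **`χ₁₂ := χ′₁ ⊠ χ′₂`**, the character `(u₁,u₂) ↦ χ′₁(u₁) χ′₂(u₂)` of `[T]`. -/
def charPair (ξ₁ ξ₂ : PontryaginDual (relNormOneIdeles K L ⧸ relNormOneRat K L)) :
    PontryaginDual (SeesawTorus K L ⧸ rat K L) :=
  ξ₁.comp (quotFstC K L) * ξ₂.comp (quotSndC K L)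

/-- (Ported verbatim from the HodgeCMPerL package; no docstring in the source.) -/
@[simp] theorem charFst_apply (ξ : PontryaginDual (SeesawTorus K L ⧸ rat K L)) (q : relNormOneIdeles K L ⧸ relNormOneRat K L) :
    charFst ξ q = ξ (quotInl K L q) := rfl

/-- (Ported verbatim from the HodgeCMPerL package; no docstring in the source.) -/
@[simp] theorem charSnd_apply (ξ : PontryaginDual (SeesawTorus K L ⧸ rat K L)) (q : relNormOneIdeles K L ⧸ relNormOneRat K L) :
    charSnd ξ q = ξ (quotInr K L q) := rfl

/-- (Ported verbatim from the HodgeCMPerL package; no docstring in the source.) -/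
@[simp] theorem charPair_apply (ξ₁ ξ₂ : PontryaginDual (relNormOneIdeles K L ⧸ relNormOneRat K L))
    (q : SeesawTorus K L ⧸ rat K L) : charPair ξ₁ ξ₂ q = ξ₁ (quotFst K L q) * ξ₂ (quotSnd K L q) := rfl

/-- `χ₁₂(u₁, u₂) = χ′₁(u₁) χ′₂(u₂)`. -/
theorem charPair_mk (ξ₁ ξ₂ : PontryaginDual (relNormOneIdeles K L ⧸ relNormOneRat K L)) (u₁ u₂ : relNormOneIdeles K L) :
    charPair ξ₁ ξ₂ (QuotientGroup.mk (mk K L u₁ u₂)) = ξ₁ (QuotientGroup.mk u₁) * ξ₂ (QuotientGroup.mk u₂) := rfl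

/-- **Every character of `[T]` factors**: `ξ(u₁,u₂) = χ′₁(u₁) χ′₂(u₂)` with `(χ′₁, χ′₂) := ξ`. -/
theorem char_apply_eq (ξ : PontryaginDual (SeesawTorus K L ⧸ rat K L)) (q : SeesawTorus K L ⧸ rat K L) :
    ξ q = charFst ξ (quotFst K L q) * charSnd ξ (quotSnd K L q) := by
  rw [charFst_apply, charSnd_apply, ← map_mul, quotInl_quotFst_mul_quotInr_quotSnd]

/-- (Ported verbatim from the HodgeCMPerL package; no docstring in the source.) -/
theorem char_apply_mk (ξ : PontryaginDual (SeesawTorus K L ⧸ rat K L)) (u₁ u₂ : relNormOneIdeles K L) :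
    ξ (QuotientGroup.mk (mk K L u₁ u₂)) =
      charFst ξ (QuotientGroup.mk u₁) * charSnd ξ (QuotientGroup.mk u₂) :=
  char_apply_eq ξ _

/-- (Ported verbatim from the HodgeCMPerL package; no docstring in the source.) -/
@[simp] theorem charPair_charFst_charSnd (ξ : PontryaginDual (SeesawTorus K L ⧸ rat K L)) :
    charPair (charFst ξ) (charSnd ξ) = ξ :=
  ContinuousMonoidHom.ext fun q => (char_apply_eq ξ q).symm

/-- (Ported verbatim from the HodgeCMPerL package; no docstring in the source.) -/
theorem charFst_charPair_apply (ξ₁ ξ₂ : PontryaginDual (relNormOneIdeles K L ⧸ relNormOneRat K L))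
    (q : relNormOneIdeles K L ⧸ relNormOneRat K L) : charFst (charPair ξ₁ ξ₂) q = ξ₁ q := by
  rw [charFst_apply, charPair_apply, quotFst_quotInl, quotSnd_quotInl, map_one, mul_one]

/-- (Ported verbatim from the HodgeCMPerL package; no docstring in the source.) -/
theorem charSnd_charPair_apply (ξ₁ ξ₂ : PontryaginDual (relNormOneIdeles K L ⧸ relNormOneRat K L))
    (q : relNormOneIdeles K L ⧸ relNormOneRat K L) : charSnd (charPair ξ₁ ξ₂) q = ξ₂ q := by
  rw [charSnd_apply, charPair_apply, quotFst_quotInr, quotSnd_quotInr, map_one, one_mul]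

/-- (Ported verbatim from the HodgeCMPerL package; no docstring in the source.) -/
@[simp] theorem charFst_charPair (ξ₁ ξ₂ : PontryaginDual (relNormOneIdeles K L ⧸ relNormOneRat K L)) :
    charFst (charPair ξ₁ ξ₂) = ξ₁ :=
  ContinuousMonoidHom.ext fun q => charFst_charPair_apply ξ₁ ξ₂ q

/-- (Ported verbatim from the HodgeCMPerL package; no docstring in the source.) -/
@[simp] theorem charSnd_charPair (ξ₁ ξ₂ : PontryaginDual (relNormOneIdeles K L ⧸ relNormOneRat K L)) :
    charSnd (charPair ξ₁ ξ₂) = ξ₂ :=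
  ContinuousMonoidHom.ext fun q => charSnd_charPair_apply ξ₁ ξ₂ q

/-- (Ported verbatim from the HodgeCMPerL package; no docstring in the source.) -/
theorem charFst_mul (ξ η : PontryaginDual (SeesawTorus K L ⧸ rat K L)) : charFst (ξ * η) = charFst ξ * charFst η := rfl

/-- (Ported verbatim from the HodgeCMPerL package; no docstring in the source.) -/
theorem charSnd_mul (ξ η : PontryaginDual (SeesawTorus K L ⧸ rat K L)) : charSnd (ξ * η) = charSnd ξ * charSnd η := rfl

variable (K L) in
/-- **`(χ′₁, χ′₂) := ξ`**: the characters of `[T]` ARE the pairs of characters of `[U(W₁)]`, `[U(W₂)]`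
(a group isomorphism `PontryaginDual [T] ≃* PontryaginDual [U(W₁)] × PontryaginDual [U(W₂)]`, inverse `χ′₁ ⊠ χ′₂`). -/
def charEquiv : PontryaginDual (SeesawTorus K L ⧸ rat K L) ≃*
    PontryaginDual (relNormOneIdeles K L ⧸ relNormOneRat K L) × PontryaginDual (relNormOneIdeles K L ⧸ relNormOneRat K L) where
  toFun ξ := (charFst ξ, charSnd ξ)
  invFun p := charPair p.1 p.2
  left_inv ξ := charPair_charFst_charSnd ξ
  right_inv p := Prod.ext (charFst_charPair p.1 p.2) (charSnd_charPair p.1 p.2)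
  map_mul' ξ η := Prod.ext (charFst_mul ξ η) (charSnd_mul ξ η)

/-- (Ported verbatim from the HodgeCMPerL package; no docstring in the source.) -/
@[simp] theorem charEquiv_apply (ξ : PontryaginDual (SeesawTorus K L ⧸ rat K L)) :
    charEquiv K L ξ = (charFst ξ, charSnd ξ) := rfl

/-- (Ported verbatim from the HodgeCMPerL package; no docstring in the source.) -/
@[simp] theorem charEquiv_symm_apply
    (p : PontryaginDual (relNormOneIdeles K L ⧸ relNormOneRat K L) × PontryaginDual (relNormOneIdeles K L ⧸ relNormOneRat K L)) :
    (charEquiv K L).symm p = charPair p.1 p.2 := rfl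

/-- A character of `[T]` as a homomorphism `[T] →* ℂ` — pv06-g3's `dualChar ξ := Circle.coeHom.comp ξ.toMonoidHom`
(`AnnihilationModel.lean`), restated so that this file imports no run-26 module. -/
abbrev toComplexChar {G : Type} [Monoid G] [TopologicalSpace G] (ξ : PontryaginDual G) : G →* ℂ :=
  Circle.coeHom.comp ξ.toMonoidHom

/-- (Ported verbatim from the HodgeCMPerL package; no docstring in the source.) -/
theorem toComplexChar_apply {G : Type} [Monoid G] [TopologicalSpace G] (ξ : PontryaginDual G) (g : G) :
    toComplexChar ξ g = ((ξ g : Circle) : ℂ) := rfl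

end Characters

section Types

variable (L : Type) [Field L] [NumberField L] [IsCMField L]

local notation "L⁺" => maximalRealSubfield L

/-- `cl_j : U(W_j)(L₀ ⊗ ℝ) → [U(W_j)]` for the CM extension. -/
abbrev unitaryLineArchToQuot : unitaryLineArchTorus L →* relNormOneIdeles L⁺ L ⧸ relNormOneRat L⁺ L :=
  relNormOneInfToQuot L⁺ L

/-- "`χ′` has archimedean type `m`": `χ′ ∘ cl_j = archWeight m` as homomorphisms `U(W_j)(L₀⊗ℝ) →* ℂ`. -/
def HasArchType (χ : PontryaginDual (relNormOneIdeles L⁺ L ⧸ relNormOneRat L⁺ L)) (m : InfinitePlace L → ℤ) : Prop :=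
  (toComplexChar χ).comp (unitaryLineArchToQuot L) = archWeight L m

variable {L}

/-- (Ported verbatim from the HodgeCMPerL package; no docstring in the source.) -/
theorem hasArchType_iff (χ : PontryaginDual (relNormOneIdeles L⁺ L ⧸ relNormOneRat L⁺ L)) (m : InfinitePlace L → ℤ) :
    HasArchType L χ m ↔ ∀ t : unitaryLineArchTorus L, ((χ (relNormOneInfToQuot L⁺ L t) : Circle) : ℂ) = archWeight L m t := by
  constructor
  · intro h t
    exact DFunLike.congr_fun h t
  · intro h
    exact MonoidHom.ext h

/-- **The type condition of Prop. 3.6 Step 2 (ll. 423–427) on the genuine torus**: for a character `ξ` of `[T]` and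
the weight `w` of type `(m₁, m₂)`,
`ξ_∞ = w` (pv06-g3: `(dualChar ξ).comp cl = w`, with `cl = SeesawArchTorus.toQuot L`)
**iff** `χ′₁ := ξ|_{[U(W₁)]}` has archimedean type `m₁` **and** `χ′₂ := ξ|_{[U(W₂)]}` has archimedean type `m₂` —
"`(χ′₁,χ′₂) := ξ` is then a pair of automorphic characters of the forced archimedean types". -/
theorem weight_comp_archToQuot_iff (ξ : PontryaginDual (SeesawTorus L⁺ L ⧸ rat L⁺ L)) (m₁ m₂ : InfinitePlace L → ℤ) :
    (toComplexChar ξ).comp (SeesawArchTorus.toQuot L) = SeesawArchTorus.weight L m₁ m₂ ↔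
      HasArchType L (charFst ξ) m₁ ∧ HasArchType L (charSnd ξ) m₂ := by
  constructor
  · intro h
    have h' : ∀ t, ((ξ (SeesawArchTorus.toQuot L t) : Circle) : ℂ) = SeesawArchTorus.weight L m₁ m₂ t :=
      fun t => DFunLike.congr_fun h t
    refine ⟨MonoidHom.ext fun t => ?_, MonoidHom.ext fun t => ?_⟩
    · change ((ξ (quotInl L⁺ L (relNormOneInfToQuot L⁺ L t)) : Circle) : ℂ) = archWeight L m₁ t
      rw [← SeesawArchTorus.toQuot_inl, h', SeesawArchTorus.weight_inl]
    · change ((ξ (quotInr L⁺ L (relNormOneInfToQuot L⁺ L t)) : Circle) : ℂ) = archWeight L m₂ t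
      rw [← SeesawArchTorus.toQuot_inr, h', SeesawArchTorus.weight_inr]
  · rintro ⟨h₁, h₂⟩
    refine MonoidHom.ext fun t => ?_
    change ((ξ (SeesawArchTorus.toQuot L t) : Circle) : ℂ) = SeesawArchTorus.weight L m₁ m₂ t
    rw [char_apply_eq ξ, Circle.coe_mul, SeesawArchTorus.quotFst_toQuot, SeesawArchTorus.quotSnd_toQuot,
      SeesawArchTorus.weight_apply]
    exact congrArg₂ (· * ·) ((hasArchType_iff _ _).mp h₁ _) ((hasArchType_iff _ _).mp h₂ _)

/-- The same statement for `χ₁₂ = χ′₁ ⊠ χ′₂` given as a pair: `(χ′₁ ⊠ χ′₂)_∞ = w(m₁,m₂)` iff `χ′_j` has type `m_j`. -/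
theorem weight_comp_archToQuot_charPair_iff (ξ₁ ξ₂ : PontryaginDual (relNormOneIdeles L⁺ L ⧸ relNormOneRat L⁺ L))
    (m₁ m₂ : InfinitePlace L → ℤ) :
    (toComplexChar (charPair ξ₁ ξ₂)).comp (SeesawArchTorus.toQuot L) = SeesawArchTorus.weight L m₁ m₂ ↔
      HasArchType L ξ₁ m₁ ∧ HasArchType L ξ₂ m₂ := by
  rw [weight_comp_archToQuot_iff, charFst_charPair, charSnd_charPair]

/-- Archimedean types are unique: a character of `[U(W_j)]` has at most one type `m` … -/
theorem HasArchType.archWeight_eq {χ : PontryaginDual (relNormOneIdeles L⁺ L ⧸ relNormOneRat L⁺ L)}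
    {m m' : InfinitePlace L → ℤ} (h : HasArchType L χ m) (h' : HasArchType L χ m') : archWeight L m = archWeight L m' :=
  h.symm.trans h'

/-- … and types multiply: if `χ` has type `m` and `χ'` has type `m'` then `χχ'` has type `m + m'`. -/
theorem HasArchType.mul {χ χ' : PontryaginDual (relNormOneIdeles L⁺ L ⧸ relNormOneRat L⁺ L)}
    {m m' : InfinitePlace L → ℤ} (h : HasArchType L χ m) (h' : HasArchType L χ' m') :
    HasArchType L (χ * χ') (m + m') := by
  rw [hasArchType_iff] at h h' ⊢
  intro t
  rw [archWeight_add, ← h t, ← h' t, ← Circle.coe_mul]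
  rfl

/-- The trivial character has type `0`. -/
theorem hasArchType_one : HasArchType L (1 : PontryaginDual (relNormOneIdeles L⁺ L ⧸ relNormOneRat L⁺ L)) 0 := by
  rw [hasArchType_iff]
  intro t
  rw [archWeight_zero]
  rfl

end Types

end SeesawTorus

end NumberField

end
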